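import Literature.NumberTheory.Automorphic.Liu2021.AppendixC.OmegaHomHeckeOperator
import Literature.NumberTheory.Automorphic.HeckeFixedVectorsIntertwinersSemilinear
import HarnessLib

/-!
# [Liu 2021, p. 133 (D.3)] Hecke-equivariant images of `ω^K` in `ℚ̄_ℓ ⊗ H¹_ét(A_∞)` are values of elements of the Hom-space
# `Hom_{ℚ̄_ℓ[𝔾]}(ι_ℓ ∘ ω, ℚ̄_ℓ ⊗ H¹_ét(A_∞))` — the Hecke-module half of the d6 S2′ binder `hIsoSpan`

Topic `NumberTheory/Automorphic/Liu2021/AppendixC`; namespace `Literature.NumberTheory.Automorphic.Liu2021.AppendixC.Sec42Data.EtaleHeckeDatum`.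
THEOREMS ONLY (no definition, no named fact, no instance, no `sorry`).  Print, [Liu2021] p. 133 (D.3): `H¹_B(A_K^st, ℂ) ≃ ⊕_{π^∞}
H¹_B(Sh(G,h)_K, ℂ)[(π^∞)^K]` «of `C_c^∞(K\G(𝔸^∞)/K, ℚ)`-modules» — the `(π^∞)^K`-isotypic part of the level-`K` cohomology is swept out by the
`G(𝔸^∞)`-intertwiners `π^∞ → H¹(A_∞)`; the mechanism is [Bump1997] Prop. 4.2.3 / [BushnellHenniart2006] §4.3 («`π^K ≠ 0` determines `π`»), proved
generically in ★ `HeckeFixedVectorsIntertwiners` / `HeckeFixedVectorsIntertwinersSemilinear` for an IRREDUCIBLE source and a SEMISIMPLE target.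

This file instantiates it at the tree's étale tower: `(W, ρW)` a `ℂ[𝔾]`-module («`ω(μ,ε,χ)`», irreducible), `X : C.EtaleHeckeDatum ℓ` (the Hecke
action `rhoEt` on `H¹_ét(A_∞ ⊗ Ē, ℚ_ℓ) = C.etaleH1Tower ℓ`), `ι : ℂ ≃ ℚ̄_ℓ`, and the `ℚ̄_ℓ`-linear extension `σ` of `rhoEt` to `ℚ̄_ℓ ⊗ H¹_ét(A_∞)`,
entered as an EXPLICIT BINDER `(σ) (hσ : ∀ g, σ g = (X.rhoEt g).baseChange ℚ̄_ℓ)` (no definition is made) and assumed SEMISIMPLE — the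
`G`-level semisimplicity sentence of (D.3) (cell `hodgecm-mathlib`: the S1c fact of the d6 line, typed `G`-level per A-plan1 (g13) 2026-08-30).

* `exists_mem_omegaHom_extending` — for a small level `K` and an `ι`-semilinear `L : W → ℚ̄_ℓ ⊗ H¹_ét(A_∞)` carrying `ω^K` into the
  `K`-invariants and commuting on `ω^K` with the Hecke operators (`L [KgK]_ω = (1 ⊗ [KgK]_{rhoEt}) L`), some `f ∈ X.omegaHom ι ρW` agrees with
  `L` on `ω^K`;
* `apply_mem_blockValues_of_heckeEquivariant` / `map_fixedPoints_le_span_blockValues` — hence every such image `L(ω^K)` consists of BLOCK VALUES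
  `{y | ∃ f ∈ X.omegaHom ι ρW, ∃ w, f w = y}` (the right-hand side of the S2′ binder `hIsoSpan` / `BlockShape′` (4′)).

Count-neutral (`--supports` the crux `HLiu418` = stmt-HodgeConjecture-24832); HC_CM is proved only modulo the 7 printed citations until rung 0 closes.

## References
* [Liu2021] Y. Liu, *Fourier–Jacobi cycles and arithmetic relative trace formula*, Camb. J. Math. 9 (2021), p. 133 (D.3) (FJcycle.tex l. 5463–5470),
  §4.2 (l. 2158–2166).
* [Bump1997] D. Bump, *Automorphic Forms and Representations* (1997), Prop. 4.2.3 (p. 427).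
* [BushnellHenniart2006] C. J. Bushnell, G. Henniart, *The Local Langlands Conjecture for GL(2)* (2006), §4.3 Proposition (2) (pp. 38–39).
-/

set_option autoImplicit false

noncomputable section

open MulAction NumberField
open scoped TensorProduct

namespace Literature.NumberTheory.Automorphic.Liu2021.AppendixC

variable {F E : Type} [Field F] [NumberField F] [IsTotallyReal F] [Field E] [NumberField E] [Algebra F E]
  [IsTotallyComplex E] [Algebra.IsQuadraticExtension F E]
variable {P5 : PropC5Data F E} {isotropicAt : ℕ → Prop}

namespace Sec42Data.EtaleHeckeDatum

variable {C : Sec42Data P5 isotropicAt} {ℓ : ℕ} [Fact ℓ.Prime]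
variable (X : C.EtaleHeckeDatum ℓ) (ι : ℂ ≃+* AlgebraicClosure ℚ_[ℓ]) {W : Type} [AddCommGroup W] [Module ℂ W]
  (ρW : Representation ℂ C.G W)
  (σ : Representation (AlgebraicClosure ℚ_[ℓ]) C.G (AlgebraicClosure ℚ_[ℓ] ⊗[ℚ_[ℓ]] C.etaleH1Tower ℓ))
  (hσ : ∀ g : C.G, σ g = (X.rhoEt g).baseChange (AlgebraicClosure ℚ_[ℓ]))

/-- The double cosets of a small level are finite unions of left cosets (`K` compact open). [cite: Bump1997, Prop. 4.2.3] -/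
theorem finite_orbit_smallLevel (K : C5.SmallLevel C.S.K₀) (g : C.G) :
    (orbit (K.1.1 : Subgroup C.G) (g : C.G ⧸ (K.1.1 : Subgroup C.G))).Finite := by
  haveI := Literature.NumberTheory.Automorphic.isHeckeTriple_top_of_isCompact_isOpen (K.1.1 : Subgroup C.G) K.1.2.2 K.1.2.1
  exact Literature.NumberTheory.Automorphic.finite_orbit_quotient (K.1.1 : Subgroup C.G) g

set_option maxHeartbeats 400000 in
include hσ in
/-- The Hecke operators of the `ℚ̄_ℓ`-linear extension `σ` are the base changes of those of `rhoEt` (finite double cosets).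
[cite: Liu2021, §4.2 (FJcycle.tex l. 2160–2166)] -/
theorem heckeOperator_eq_baseChange_of_eq (K : Subgroup C.G) (g : C.G) (hfin : (orbit K (g : C.G ⧸ K)).Finite)
    (y : AlgebraicClosure ℚ_[ℓ] ⊗[ℚ_[ℓ]] C.etaleH1Tower ℓ) :
    heckeOperator σ K g y = (heckeOperator X.rhoEt K g).baseChange (AlgebraicClosure ℚ_[ℓ]) y := by
  classical
  rw [heckeOperator, heckeOperator, finsum_mem_eq_finite_toFinset_sum _ hfin, finsum_mem_eq_finite_toFinset_sum _ hfin,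
    LinearMap.sum_apply]
  induction hfin.toFinset using Finset.induction_on with
  | empty => simp
  | insert a s ha ih => rw [Finset.sum_insert ha, Finset.sum_insert ha, LinearMap.baseChange_add, LinearMap.add_apply, ih, hσ]

include hσ in
/-- An `ι`-semilinear map `W → ℚ̄_ℓ ⊗ H¹_ét(A_∞)` intertwining `ρW` with `σ` lies in the Hom-space `X.omegaHom ι ρW`.
[cite: Liu2021, §4.2 (FJcycle.tex l. 2162–2165)] -/
theorem mem_omegaHom_of_forall_apply_eq
    (f : W →ₛₗ[(ι : ℂ →+* AlgebraicClosure ℚ_[ℓ])] AlgebraicClosure ℚ_[ℓ] ⊗[ℚ_[ℓ]] C.etaleH1Tower ℓ)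
    (hf : ∀ (g : C.G) (w : W), f (ρW g w) = σ g (f w)) : f ∈ X.omegaHom ι ρW := by
  rw [mem_omegaHom_iff]
  intro g w
  rw [hf, hσ]

include hσ in
/-- **Hecke-equivariant `ι`-semilinear maps on `ω^K` extend to elements of the Hom-space** ([Liu2021] (D.3) mechanism; [Bump1997] 4.2.3 (b)
in surjective form, ★ `exists_semilinear_intertwiner_extending`): for `ρW` irreducible, `σ` (`= 1 ⊗ rhoEt`) SEMISIMPLE, a small level `K` and
`L : W →ₛₗ[ι] ℚ̄_ℓ ⊗ H¹_ét(A_∞)` with `L(ω^K) ⊆ (ℚ̄_ℓ ⊗ H¹)^K` and `L ([KgK] w) = (1 ⊗ [KgK]) (L w)` on `ω^K`, some `f ∈ X.omegaHom ι ρW`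
agrees with `L` on `ω^K`. [cite: Liu2021, p. 133 (D.3)] [cite: Bump1997, Prop. 4.2.3] [cite: BushnellHenniart2006, §4.3 Proposition (2) (pp. 38–39)] -/
theorem exists_mem_omegaHom_extending [ρW.IsIrreducible] [σ.IsSemisimpleRepresentation] (K : C5.SmallLevel C.S.K₀)
    (L : W →ₛₗ[(ι : ℂ →+* AlgebraicClosure ℚ_[ℓ])] AlgebraicClosure ℚ_[ℓ] ⊗[ℚ_[ℓ]] C.etaleH1Tower ℓ)
    (hLK : ∀ w ∈ ρW.fixedPoints (K.1.1 : Subgroup C.G), ∀ k ∈ (K.1.1 : Subgroup C.G),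
      (X.rhoEt k).baseChange (AlgebraicClosure ℚ_[ℓ]) (L w) = L w)
    (hL : ∀ (g : C.G), ∀ w ∈ ρW.fixedPoints (K.1.1 : Subgroup C.G),
      L (heckeOperator ρW K.1.1 g w) = (heckeOperator X.rhoEt K.1.1 g).baseChange (AlgebraicClosure ℚ_[ℓ]) (L w)) :
    ∃ f ∈ X.omegaHom ι ρW, ∀ w ∈ ρW.fixedPoints (K.1.1 : Subgroup C.G), f w = L w := by
  have hfin := finite_orbit_smallLevel (C := C) K
  obtain ⟨f, hfG, hfL⟩ := exists_semilinear_intertwiner_extending ι ρW σ (K.1.1 : Subgroup C.G) hfin L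
    (fun w hw => by
      rw [Representation.mem_fixedPoints]
      intro k hk
      rw [hσ]
      exact hLK w hw k hk)
    (fun g w hw => by rw [hL g w hw, heckeOperator_eq_baseChange_of_eq X σ hσ _ g (hfin g)])
  exact ⟨f, mem_omegaHom_of_forall_apply_eq X ι ρW σ hσ f hfG, hfL⟩

include hσ in
/-- **Hecke-equivariant images of `ω^K` consist of block values**: under the hypotheses of `exists_mem_omegaHom_extending`, `L w` for `w ∈ ω^K`
is a value of an element of `X.omegaHom ι ρW`. [cite: Liu2021, p. 133 (D.3)] [cite: Bump1997, Prop. 4.2.3] -/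
theorem apply_mem_blockValues_of_heckeEquivariant [ρW.IsIrreducible] [σ.IsSemisimpleRepresentation] (K : C5.SmallLevel C.S.K₀)
    (L : W →ₛₗ[(ι : ℂ →+* AlgebraicClosure ℚ_[ℓ])] AlgebraicClosure ℚ_[ℓ] ⊗[ℚ_[ℓ]] C.etaleH1Tower ℓ)
    (hLK : ∀ w ∈ ρW.fixedPoints (K.1.1 : Subgroup C.G), ∀ k ∈ (K.1.1 : Subgroup C.G),
      (X.rhoEt k).baseChange (AlgebraicClosure ℚ_[ℓ]) (L w) = L w)
    (hL : ∀ (g : C.G), ∀ w ∈ ρW.fixedPoints (K.1.1 : Subgroup C.G),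
      L (heckeOperator ρW K.1.1 g w) = (heckeOperator X.rhoEt K.1.1 g).baseChange (AlgebraicClosure ℚ_[ℓ]) (L w))
    {w : W} (hw : w ∈ ρW.fixedPoints (K.1.1 : Subgroup C.G)) :
    L w ∈ {y | ∃ f ∈ X.omegaHom ι ρW, ∃ w : W, f w = y} := by
  obtain ⟨f, hf, hfL⟩ := exists_mem_omegaHom_extending X ι ρW σ hσ K L hLK hL
  exact ⟨f, hf, w, hfL w hw⟩

include hσ in
/-- **`L(ω^K) ⊆ span(block values)`** — the form consumed by the S2′ binder («every Hecke-submodule of `ℚ̄_ℓ ⊗ H¹` that is a Hecke-equivariant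
image of `ω^K` lies in the span of the block values»). [cite: Liu2021, p. 133 (D.3)] [cite: Bump1997, Prop. 4.2.3] -/
theorem map_fixedPoints_le_span_blockValues [ρW.IsIrreducible] [σ.IsSemisimpleRepresentation] (K : C5.SmallLevel C.S.K₀)
    (L : W →ₛₗ[(ι : ℂ →+* AlgebraicClosure ℚ_[ℓ])] AlgebraicClosure ℚ_[ℓ] ⊗[ℚ_[ℓ]] C.etaleH1Tower ℓ)
    (hLK : ∀ w ∈ ρW.fixedPoints (K.1.1 : Subgroup C.G), ∀ k ∈ (K.1.1 : Subgroup C.G),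
      (X.rhoEt k).baseChange (AlgebraicClosure ℚ_[ℓ]) (L w) = L w)
    (hL : ∀ (g : C.G), ∀ w ∈ ρW.fixedPoints (K.1.1 : Subgroup C.G),
      L (heckeOperator ρW K.1.1 g w) = (heckeOperator X.rhoEt K.1.1 g).baseChange (AlgebraicClosure ℚ_[ℓ]) (L w)) :
    (ρW.fixedPoints (K.1.1 : Subgroup C.G)).map L ≤
      Submodule.span (AlgebraicClosure ℚ_[ℓ]) {y | ∃ f ∈ X.omegaHom ι ρW, ∃ w : W, f w = y} := by
  rintro _ ⟨w, hw, rfl⟩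
  exact Submodule.subset_span (apply_mem_blockValues_of_heckeEquivariant X ι ρW σ hσ K L hLK hL hw)

end Sec42Data.EtaleHeckeDatum

end Literature.NumberTheory.Automorphic.Liu2021.AppendixC
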